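import Summits.Parity.BatemanHorn.Theorems.SystemLSDRealSegment.Negative.Engines
import Literature.NumberTheory.Sieve.BatemanHorn

/-!
# `SystemLSDRealSegment` — structure of the conclusion (what the real-segment law forces on `Λ`)

Structural facts about the conclusion of the crux
    `Summit.Parity.BatemanHorn.Theses.AlmostPrimeZeros.SystemLSDRealSegment`
(stmt-Parity-11292), from the standing disprover's work file `Cruxes/SystemLSDRealSegment/Disproof.lean` §4, for
any family `f` and any `Λ` satisfying the segment law
`x⁻¹ e^{k(1-y) log log x} Σ_{n≤x} y^{s_f(n)} → Λ(y) e^{(y-1) log D} Γ(y)^{-k}` for real `y ∈ (5/4, 7/4)`: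

* `Λ_unique` — two such `Λ`'s holomorphic on `|z| < 2` coincide on the ball (no `∃`-slack; `Λ 0` is determined);
* `segmentLaw_update_zero` — WITHOUT holomorphy the clause `Λ 0 = C(f)` pins nothing (`update Λ 0 c` satisfies
  the same law for every `c`): holomorphy is what gives the clause its teeth;
* `Λ_real_nonneg_of_law` — positivity passes to the limit: `Λ(y)` is real and `≥ 0` on the segment;
* `Λ_conj_symm`, `Λ_real_on_diameter` — Schwarz symmetry: `Λ` is real on the whole diameter `(-2, 2)`,
  consistent with `Λ(0) = C(f) ∈ ℝ` and with the conjectured Euler product `λ_f` (real coefficients).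
-/

open Filter Polynomial Finset
open scoped Topology

namespace Summit.Parity.BatemanHorn.Theorems.SystemLSDRealSegment.Negative

/-- UNIQUENESS: two `Λ`'s holomorphic on `|z| < 2` satisfying the segment law for the same `(k, f)` coincide on
`ball 0 2` (limits are unique, the Γ-factor is non-zero, identity theorem). [folklore] -/
theorem Λ_unique {k : ℕ} {f : Fin k → ℤ[X]} {Λ₁ Λ₂ : ℂ → ℂ}
    (h₁ : DifferentiableOn ℂ Λ₁ (Metric.ball 0 2)) (h₂ : DifferentiableOn ℂ Λ₂ (Metric.ball 0 2))
    (l₁ : ∀ y : ℝ, 5 / 4 < y → y < 7 / 4 → Tendsto (fun x : ℕ => ((x : ℂ)⁻¹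
        * Complex.exp ((k : ℂ) * (1 - (y : ℂ)) * (Real.log (Real.log x) : ℂ))
        * ∑ n ∈ Finset.range (x + 1), (y : ℂ) ^ (∑ i, (((f i).eval (n : ℤ)).toNat.factorization.sum
        fun _ v => min v 2)))) atTop (𝓝 (Λ₁ y * (Complex.exp (((y : ℂ) - 1) *
        (Real.log (∏ i, ((f i).natDegree : ℝ)) : ℂ)) * (Complex.Gamma y)⁻¹ ^ k))))
    (l₂ : ∀ y : ℝ, 5 / 4 < y → y < 7 / 4 → Tendsto (fun x : ℕ => ((x : ℂ)⁻¹
        * Complex.exp ((k : ℂ) * (1 - (y : ℂ)) * (Real.log (Real.log x) : ℂ))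
        * ∑ n ∈ Finset.range (x + 1), (y : ℂ) ^ (∑ i, (((f i).eval (n : ℤ)).toNat.factorization.sum
        fun _ v => min v 2)))) atTop (𝓝 (Λ₂ y * (Complex.exp (((y : ℂ) - 1) *
        (Real.log (∏ i, ((f i).natDegree : ℝ)) : ℂ)) * (Complex.Gamma y)⁻¹ ^ k)))) :
    Set.EqOn Λ₁ Λ₂ (Metric.ball 0 2) := by
  refine eqOn_ball_of_eqOn_segment h₁ h₂ fun y hy hy' => ?_
  have := tendsto_nhds_unique (l₁ y hy hy') (l₂ y hy hy')
  exact mul_right_cancel₀ (gammaFactor_ne_zero k _ (by linarith)) this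

/-- WITHOUT HOLOMORPHY THE `Λ 0`-CLAUSE IS VACUOUS: from any `Λ` satisfying the segment law and ANY `c`, the
function `update Λ 0 c` satisfies the same law and takes the value `c` at `0` (`0 ∉ (5/4, 7/4)`). So it is the
holomorphy of `Λ` on `ball 0 2` (via `eqOn_ball_of_eqOn_segment`) that makes `Λ 0 = batemanHornConst f` a
genuine claim: the crux asserts that the ANALYTIC CONTINUATION of the real-segment law to `0` is the singular
series. [folklore] -/
theorem segmentLaw_update_zero {k : ℕ} {f : Fin k → ℤ[X]} {Λ : ℂ → ℂ}
    (hlaw : ∀ y : ℝ, 5 / 4 < y → y < 7 / 4 →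
      Tendsto (fun x : ℕ => ((x : ℂ)⁻¹
          * Complex.exp ((k : ℂ) * (1 - (y : ℂ)) * (Real.log (Real.log x) : ℂ))
          * ∑ n ∈ Finset.range (x + 1), (y : ℂ) ^ (∑ i, (((f i).eval (n : ℤ)).toNat.factorization.sum
          fun _ v => min v 2)))) atTop (𝓝 (Λ y * (Complex.exp (((y : ℂ) - 1) *
          (Real.log (∏ i, ((f i).natDegree : ℝ)) : ℂ)) * (Complex.Gamma y)⁻¹ ^ k)))) (c : ℂ) :
    Function.update Λ 0 c 0 = c ∧ ∀ y : ℝ, 5 / 4 < y → y < 7 / 4 →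
      Tendsto (fun x : ℕ => ((x : ℂ)⁻¹
          * Complex.exp ((k : ℂ) * (1 - (y : ℂ)) * (Real.log (Real.log x) : ℂ))
          * ∑ n ∈ Finset.range (x + 1), (y : ℂ) ^ (∑ i, (((f i).eval (n : ℤ)).toNat.factorization.sum
          fun _ v => min v 2)))) atTop (𝓝 (Function.update Λ 0 c y * (Complex.exp (((y : ℂ) - 1) *
          (Real.log (∏ i, ((f i).natDegree : ℝ)) : ℂ)) * (Complex.Gamma y)⁻¹ ^ k))) := by
  refine ⟨Function.update_self .., fun y hy hy' => ?_⟩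
  have hy0 : (y : ℂ) ≠ 0 := by exact_mod_cast (show y ≠ 0 by linarith)
  rw [Function.update_of_ne hy0]
  exact hlaw y hy hy'

/-- The archimedean factor is a POSITIVE REAL number at real `y > 0`. [folklore] -/
theorem gammaFactor_ofReal (k : ℕ) (f : Fin k → ℤ[X]) {y : ℝ} (hy : 0 < y) :
    ∃ e : ℝ, 0 < e ∧ (Complex.exp (((y : ℂ) - 1) * (Real.log (∏ i, ((f i).natDegree : ℝ)) : ℂ))
        * (Complex.Gamma y)⁻¹ ^ k) = (e : ℂ) := by
  refine ⟨Real.exp ((y - 1) * Real.log (∏ i, ((f i).natDegree : ℝ))) * (Real.Gamma y)⁻¹ ^ k, ?_, ?_⟩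
  · have := Real.Gamma_pos_of_pos hy
    positivity
  · rw [Complex.Gamma_ofReal]
    push_cast
    ring

/-- The complex normalised sum is a NON-NEGATIVE REAL number (positive weights). [folklore] -/
theorem normSum_ofReal_nonneg (k : ℕ) (f : Fin k → ℤ[X]) {y : ℝ} (hy : 0 ≤ y) (x : ℕ) :
    ∃ r : ℝ, 0 ≤ r ∧ ((x : ℂ)⁻¹ * Complex.exp ((k : ℂ) * (1 - (y : ℂ)) * (Real.log (Real.log x) : ℂ))
        * ∑ n ∈ Finset.range (x + 1), (y : ℂ) ^ (∑ i, (((f i).eval (n : ℤ)).toNat.factorization.sum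
        fun _ v => min v 2))) = (r : ℂ) := by
  refine ⟨(x : ℝ)⁻¹ * Real.exp (k * (1 - y) * Real.log (Real.log x)) * ∑ n ∈ Finset.range (x + 1), y
      ^ (∑ i, (((f i).eval (n : ℤ)).toNat.factorization.sum fun _ v => min v 2)),
    ?_, ?_⟩
  · have : 0 ≤ ∑ n ∈ Finset.range (x + 1), y ^ (∑ i, (((f i).eval (n : ℤ)).toNat.factorization.sum
      fun _ v => min v 2)) := Finset.sum_nonneg fun _ _ => pow_nonneg hy _
    positivity
  · push_cast
    rfl

/-- POSITIVITY PASSES TO THE LIMIT: the segment law forces `Λ(y)` to be REAL and `≥ 0` at every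
`y ∈ (5/4, 7/4)`. [folklore] -/
theorem Λ_real_nonneg_of_law {k : ℕ} {f : Fin k → ℤ[X]} {Λ : ℂ → ℂ}
    (hlaw : ∀ y : ℝ, 5 / 4 < y → y < 7 / 4 →
      Tendsto (fun x : ℕ => ((x : ℂ)⁻¹
          * Complex.exp ((k : ℂ) * (1 - (y : ℂ)) * (Real.log (Real.log x) : ℂ))
          * ∑ n ∈ Finset.range (x + 1), (y : ℂ) ^ (∑ i, (((f i).eval (n : ℤ)).toNat.factorization.sum
          fun _ v => min v 2)))) atTop (𝓝 (Λ y * (Complex.exp (((y : ℂ) - 1) *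
          (Real.log (∏ i, ((f i).natDegree : ℝ)) : ℂ)) * (Complex.Gamma y)⁻¹ ^ k))))
    {y : ℝ} (hy : 5 / 4 < y) (hy' : y < 7 / 4) : (Λ y).im = 0 ∧ 0 ≤ (Λ y).re := by
  obtain ⟨e, he, hE⟩ := gammaFactor_ofReal k f (by linarith : (0 : ℝ) < y)
  have hlim := hlaw y hy hy'
  rw [hE] at hlim
  choose r hr0 hr using fun x => normSum_ofReal_nonneg k f (by linarith : (0 : ℝ) ≤ y) x
  have hlim' : Tendsto (fun x : ℕ => ((r x : ℝ) : ℂ)) atTop (𝓝 (Λ y * e)) := hlim.congr hr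
  have hre : Tendsto r atTop (𝓝 (Λ y * e).re) := tendsto_re_of_tendsto_ofReal hlim'
  have him : (Λ y * e).im = 0 := by
    have h1 := (Complex.continuous_im.tendsto _).comp hlim'
    have h2 : Tendsto (fun x : ℕ => (((r x : ℝ) : ℂ)).im) atTop (𝓝 0) := by simp
    exact tendsto_nhds_unique h1 h2
  have hre0 : 0 ≤ (Λ y * e).re := ge_of_tendsto' hre hr0
  rw [Complex.mul_im, Complex.ofReal_re, Complex.ofReal_im, mul_zero, zero_add] at him
  rw [Complex.mul_re, Complex.ofReal_re, Complex.ofReal_im, mul_zero, sub_zero] at hre0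
  exact ⟨(mul_eq_zero.1 him).resolve_right he.ne', (mul_nonneg_iff_of_pos_right he).1 hre0⟩

/-- SCHWARZ SYMMETRY: a `Λ` holomorphic on `|z| < 2` and real on the segment satisfies `Λ(conj z) = conj Λ(z)`
on the ball (identity theorem applied to `z ↦ conj Λ(conj z)`). [folklore] -/
theorem Λ_conj_symm {Λ : ℂ → ℂ} (hΛ : DifferentiableOn ℂ Λ (Metric.ball 0 2))
    (hreal : ∀ y : ℝ, 5 / 4 < y → y < 7 / 4 → (Λ y).im = 0) :
    Set.EqOn Λ (fun z => starRingEnd ℂ (Λ (starRingEnd ℂ z))) (Metric.ball 0 2) := by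
  have hball : ∀ z : ℂ, z ∈ Metric.ball (0 : ℂ) 2 → starRingEnd ℂ z ∈ Metric.ball (0 : ℂ) 2 := fun z hz => by
    simpa [Metric.mem_ball, dist_zero_right, Complex.norm_conj] using hz
  have h₂ : DifferentiableOn ℂ (fun z => starRingEnd ℂ (Λ (starRingEnd ℂ z))) (Metric.ball 0 2) := by
    intro z hz
    have hd : DifferentiableAt ℂ Λ (starRingEnd ℂ z) :=
      (hΛ _ (hball z hz)).differentiableAt (Metric.isOpen_ball.mem_nhds (hball z hz))
    have h2 := hd.conj_conj
    rw [Complex.conj_conj] at h2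
    exact h2.differentiableWithinAt
  refine eqOn_ball_of_eqOn_segment hΛ h₂ fun y hy hy' => ?_
  simp only [Complex.conj_ofReal]
  exact (Complex.conj_eq_iff_im.2 (hreal y hy hy')).symm

/-- Consequence: under the segment law, a `Λ` holomorphic on `|z| < 2` is REAL at every real `t ∈ (-2, 2)` — in
particular the pinned value `Λ 0` is real, as `batemanHornConst f` is. [folklore] -/
theorem Λ_real_on_diameter {k : ℕ} {f : Fin k → ℤ[X]} {Λ : ℂ → ℂ} (hΛ : DifferentiableOn ℂ Λ (Metric.ball 0 2))
    (hlaw : ∀ y : ℝ, 5 / 4 < y → y < 7 / 4 →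
      Tendsto (fun x : ℕ => ((x : ℂ)⁻¹
          * Complex.exp ((k : ℂ) * (1 - (y : ℂ)) * (Real.log (Real.log x) : ℂ))
          * ∑ n ∈ Finset.range (x + 1), (y : ℂ) ^ (∑ i, (((f i).eval (n : ℤ)).toNat.factorization.sum
          fun _ v => min v 2)))) atTop (𝓝 (Λ y * (Complex.exp (((y : ℂ) - 1) *
          (Real.log (∏ i, ((f i).natDegree : ℝ)) : ℂ)) * (Complex.Gamma y)⁻¹ ^ k))))
    {t : ℝ} (ht : |t| < 2) : (Λ t).im = 0 := by
  have hsym := Λ_conj_symm hΛ fun y hy hy' => (Λ_real_nonneg_of_law hlaw hy hy').1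
  have hmem : ((t : ℝ) : ℂ) ∈ Metric.ball (0 : ℂ) 2 := by
    simpa [Metric.mem_ball, dist_zero_right, Complex.norm_real] using ht
  have := hsym hmem
  simp only [Complex.conj_ofReal] at this
  exact Complex.conj_eq_iff_im.1 this.symm

/-- Certificate: the segment law above is the one of the route decl (its conclusion, third conjunct, with the
limit re-associated as `Λ y * (Complex.exp (((y : ℂ) - 1) *
    (Real.log (∏ i, ((f i).natDegree : ℝ)) : ℂ)) * (Complex.Gamma y)⁻¹ ^ k)`). -/
example (k : ℕ) (f : Fin k → ℤ[X]) (Λ : ℂ → ℂ) (y : ℝ) :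
    (Tendsto (fun x : ℕ => ((x : ℂ)⁻¹
        * Complex.exp ((k : ℂ) * (1 - (y : ℂ)) * (Real.log (Real.log x) : ℂ))
        * ∑ n ∈ Finset.range (x + 1), (y : ℂ) ^ (∑ i, (((f i).eval (n : ℤ)).toNat.factorization.sum
        fun _ v => min v 2)))) atTop (𝓝 (Λ y * (Complex.exp (((y : ℂ) - 1) *
        (Real.log (∏ i, ((f i).natDegree : ℝ)) : ℂ)) * (Complex.Gamma y)⁻¹ ^ k)))) ↔
      Filter.Tendsto (fun x : ℕ => (x : ℂ)⁻¹ * Complex.exp ((k : ℂ) * (1 - (y : ℂ)) * (Real.log (Real.log x) : ℂ)) *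
        ∑ n ∈ Finset.range (x + 1), (y : ℂ) ^ (∑ i, (((f i).eval (n : ℤ)).toNat.factorization.sum
            fun _ v => min v 2)))
        Filter.atTop (nhds (Λ y * Complex.exp (((y : ℂ) - 1) * (Real.log (∏ i, ((f i).natDegree : ℝ)) : ℂ)) *
          (Complex.Gamma y)⁻¹ ^ k)) := by
  rw [mul_assoc]

end Summit.Parity.BatemanHorn.Theorems.SystemLSDRealSegment.Negative
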